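import Literature.AlgebraicGeometry.Resolution.TameQuotientSingularitiesResolutionProofs
import Mathlib.RingTheory.GradedAlgebra.Basic
import Mathlib.GroupTheory.OrderOfElement
import HarnessLib

/-!
# Crux `FrobeniusLadder.FRationalResolution` (stmt-ResolutionOfSingularities-15317), line `redirect`,
# stub `stub_diagonalizableQuotientResolution` — the quotient chart `Spec S → Spec S₀` at a FIXED point

For `S` graded by an abelian group `A` (`GradedAlgebra 𝒮`, degree-`0` part `S₀ = 𝒮 0`, i.e. an action
of the diagonalizable group scheme `D(A)` on `Spec S` with quotient `Spec S₀`), a prime `𝔔` of `S` is a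
`D(A)`-FIXED point iff it contains every homogeneous piece of non-zero degree. This file proves the
elementary structure of the quotient map at such points — the entrance of the local linearisation
step (L3 of the census) and the place where `…PrimaryDescent.lean` is applied:

* `grade_subset_of_forall_mul_mem` — for a TORSION grading group, a prime containing all products
  `s·t` (`s ∈ S_a`, `t ∈ S_{−a}`, `a ≠ 0`) already contains every `S_a`, `a ≠ 0`
  (`sⁿ = s·sⁿ⁻¹ ∈ S_a S_{−a}` for `n = ord a`);
* `sub_decompose_zero_mem` — at a fixed prime, `s ≡ s₀ (mod 𝔔)` (its degree-`0` component);
* `exists_gradeZero_sub_mem` — RESIDUE SURJECTIVITY: every `s ∈ S` is congruent modulo `𝔔` to an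
  element of `S₀` (so `κ(𝔔) = κ(𝔔 ∩ S₀)`);
* `eq_of_forall_grade_subset_of_comap_eq` — a fixed prime is determined by its contraction to `S₀`:
  TWO fixed primes with the same contraction are EQUAL (the fibre of `Spec S → Spec S₀` over the
  image of a fixed point is that single point);
* `mem_iff_decompose_zero_mem` — membership in a fixed prime is read off in degree `0`.

Honest label: elementary structure lemmas (no stub closed). No definitions, no named facts, no sorry.
[folklore; cite: SGA3, Exp. VIII §4–5 (diagonalizable groups and gradings)]
-/

noncomputable section

-- single-problem summit: the doubled namespace component is forced
set_option linter.dupNamespace false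

open DirectSum

namespace Summit.ResolutionOfSingularities.ResolutionOfSingularities.Theorems.FRationalResolution.FixedPointFibre

universe u v w

variable {R : Type u} {S : Type v} {A : Type w} [CommRing R] [CommRing S] [Algebra R S]
  [DecidableEq A] [AddCommGroup A] (𝒮 : A → Submodule R S) [GradedAlgebra 𝒮]

/-- **A prime containing the products `S_a · S_{−a}` (`a ≠ 0`) contains every `S_a`, `a ≠ 0`**, when
the grading group is torsion: for `s ∈ S_a` and `n = ord a`, `sⁿ = s · sⁿ⁻¹` with
`sⁿ⁻¹ ∈ S_{(n-1)a} = S_{−a}`, so `sⁿ ∈ 𝔔` and `s ∈ 𝔔`. [folklore] -/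
theorem grade_subset_of_forall_mul_mem (hA : AddMonoid.IsTorsion A) (𝔔 : Ideal S) [𝔔.IsPrime]
    (hprod : ∀ a : A, a ≠ 0 → ∀ s ∈ 𝒮 a, ∀ t ∈ 𝒮 (-a), s * t ∈ 𝔔) :
    ∀ a : A, a ≠ 0 → ∀ s ∈ 𝒮 a, s ∈ 𝔔 := by
  intro a ha s hs
  set n := addOrderOf a with hn
  have hnpos : 0 < n := (hA a).addOrderOf_pos
  -- `s ^ (n - 1) ∈ S_{(n-1) • a} = S_{-a}`
  have hpow : s ^ (n - 1) ∈ 𝒮 ((n - 1) • a) := SetLike.pow_mem_graded (n - 1) hs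
  have hdeg : (n - 1) • a = -a := by
    rw [eq_neg_iff_add_eq_zero, ← succ_nsmul, Nat.sub_add_cancel hnpos, hn]
    exact addOrderOf_nsmul_eq_zero a
  rw [hdeg] at hpow
  have hsn : s * s ^ (n - 1) ∈ 𝔔 := hprod a ha s hs _ hpow
  rw [← pow_succ', Nat.sub_add_cancel hnpos] at hsn
  exact Ideal.IsPrime.mem_of_pow_mem ‹_› n hsn

/-- **At a fixed prime every element is congruent to its degree-`0` component**: if `S_a ⊆ 𝔔` for all
`a ≠ 0` then `s - s₀ ∈ 𝔔` for every `s`, where `s₀ = (decompose 𝒮 s) 0`. [folklore] -/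
theorem sub_decompose_zero_mem (𝔔 : Ideal S) (hfix : ∀ a : A, a ≠ 0 → ∀ s ∈ 𝒮 a, s ∈ 𝔔) (s : S) :
    s - (decompose 𝒮 s 0 : S) ∈ 𝔔 := by
  classical
  have hsum : s = ∑ a ∈ (decompose 𝒮 s).support, (decompose 𝒮 s a : S) :=
    (sum_support_decompose 𝒮 s).symm
  -- split off the degree-`0` term
  have hsplit : s - (decompose 𝒮 s 0 : S) =
      ∑ a ∈ (decompose 𝒮 s).support.erase 0, (decompose 𝒮 s a : S) := by
    by_cases h0 : (0 : A) ∈ (decompose 𝒮 s).support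
    · rw [← Finset.add_sum_erase _ _ h0] at hsum
      rw [sub_eq_iff_eq_add']
      exact hsum
    · have hz : (decompose 𝒮 s 0 : S) = 0 := by
        rw [DFinsupp.notMem_support_iff.mp h0]; rfl
      rw [hz, sub_zero, Finset.erase_eq_of_notMem h0]
      exact hsum
  rw [hsplit]
  refine Ideal.sum_mem _ fun a ha => ?_
  exact hfix a (Finset.ne_of_mem_erase ha) _ (SetLike.coe_mem _)

/-- **Residue surjectivity at a fixed point**: every `s ∈ S` is congruent modulo the fixed prime `𝔔`
to an element of `S₀` (so `S₀/(𝔔 ∩ S₀) → S/𝔔` is onto and the residue fields agree). [folklore] -/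
theorem exists_gradeZero_sub_mem (𝔔 : Ideal S) (hfix : ∀ a : A, a ≠ 0 → ∀ s ∈ 𝒮 a, s ∈ 𝔔)
    (s : S) : ∃ s₀ : 𝒮 0, s - algebraMap (𝒮 0) S s₀ ∈ 𝔔 :=
  ⟨decompose 𝒮 s 0, sub_decompose_zero_mem 𝒮 𝔔 hfix s⟩

/-- **Membership in a fixed prime is read off in degree `0`.** [folklore] -/
theorem mem_iff_decompose_zero_mem (𝔔 : Ideal S) (hfix : ∀ a : A, a ≠ 0 → ∀ s ∈ 𝒮 a, s ∈ 𝔔)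
    (s : S) : s ∈ 𝔔 ↔ (decompose 𝒮 s 0 : S) ∈ 𝔔 := by
  have h := sub_decompose_zero_mem 𝒮 𝔔 hfix s
  constructor
  · intro hs
    have : (decompose 𝒮 s 0 : S) = s - (s - (decompose 𝒮 s 0 : S)) := by ring
    rw [this]
    exact 𝔔.sub_mem hs h
  · intro hs0
    have : s = (s - (decompose 𝒮 s 0 : S)) + (decompose 𝒮 s 0 : S) := by ring
    rw [this]
    exact 𝔔.add_mem h hs0

/-- **A fixed prime is determined by its contraction to `S₀`**: two ideals of `S` each containing
every `S_a`, `a ≠ 0`, with the same contraction to `S₀` are equal. In particular the fibre of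
`Spec S → Spec S₀` through a fixed point is that single point. [folklore] -/
theorem eq_of_forall_grade_subset_of_comap_eq (𝔔 𝔔' : Ideal S)
    (hfix : ∀ a : A, a ≠ 0 → ∀ s ∈ 𝒮 a, s ∈ 𝔔) (hfix' : ∀ a : A, a ≠ 0 → ∀ s ∈ 𝒮 a, s ∈ 𝔔')
    (hcomap : 𝔔.comap (algebraMap (𝒮 0) S) = 𝔔'.comap (algebraMap (𝒮 0) S)) : 𝔔 = 𝔔' := by
  ext s
  rw [mem_iff_decompose_zero_mem 𝒮 𝔔 hfix s, mem_iff_decompose_zero_mem 𝒮 𝔔' hfix' s]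
  have h := congrArg (fun I : Ideal (𝒮 0) => (decompose 𝒮 s 0) ∈ I) hcomap
  simp only [Ideal.mem_comap, eq_iff_iff] at h
  exact h

/-- **The fibre over the image of a fixed point is a single point, for a torsion grading**: if a
prime `𝔔` contains every `S_a`, `a ≠ 0`, then every prime `𝔔'` with the same contraction to `S₀`
equals `𝔔` (`𝔔'` contains the products `S_a S_{−a} ⊆ S₀ ∩ 𝔔 = S₀ ∩ 𝔔'`, hence every `S_a` by
`grade_subset_of_forall_mul_mem`). [folklore] -/
theorem eq_of_isPrime_of_comap_eq (hA : AddMonoid.IsTorsion A) (𝔔 𝔔' : Ideal S) [𝔔'.IsPrime]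
    (hfix : ∀ a : A, a ≠ 0 → ∀ s ∈ 𝒮 a, s ∈ 𝔔)
    (hcomap : 𝔔.comap (algebraMap (𝒮 0) S) = 𝔔'.comap (algebraMap (𝒮 0) S)) : 𝔔 = 𝔔' := by
  refine eq_of_forall_grade_subset_of_comap_eq 𝒮 𝔔 𝔔' hfix ?_ hcomap
  refine grade_subset_of_forall_mul_mem 𝒮 hA 𝔔' fun a ha s hs t ht => ?_
  -- `s * t ∈ S₀ ∩ 𝔔 = S₀ ∩ 𝔔'`
  have hst0 : s * t ∈ 𝒮 0 := by
    have := SetLike.mul_mem_graded hs ht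
    rwa [add_neg_cancel] at this
  have hstQ : s * t ∈ 𝔔 := Ideal.mul_mem_right _ _ (hfix a ha s hs)
  have hmem : (⟨s * t, hst0⟩ : 𝒮 0) ∈ 𝔔.comap (algebraMap (𝒮 0) S) := hstQ
  rw [hcomap] at hmem
  exact hmem

/-! ## A fixed ideal is generated by its degree-zero part and the pieces of non-zero degree -/

/-- **Every component of non-zero degree lies in the span of the non-zero-degree pieces.**
[folklore] -/
theorem sub_decompose_zero_mem_span (s : S) :
    s - (decompose 𝒮 s 0 : S) ∈ Ideal.span (⋃ a ∈ {a : A | a ≠ 0}, (𝒮 a : Set S)) := by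
  refine sub_decompose_zero_mem 𝒮 _ (fun a ha t ht => Ideal.subset_span ?_) s
  exact Set.mem_biUnion ha ht

/-- **A fixed ideal is generated by its degree-`0` part and the homogeneous pieces of non-zero
degree**: if `S_a ⊆ 𝔔` for all `a ≠ 0` then `𝔔 = (𝔔 ∩ S₀)·S + ⟨⋃_{a ≠ 0} S_a⟩` (so at a fixed
closed point the maximal ideal is generated by `𝔪_{S₀,𝔮}` and homogeneous elements of non-zero
degree — the first line of the linearisation step). [folklore] -/
theorem eq_map_comap_sup_span_of_fixed (𝔔 : Ideal S)
    (hfix : ∀ a : A, a ≠ 0 → ∀ s ∈ 𝒮 a, s ∈ 𝔔) :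
    𝔔 = (𝔔.comap (algebraMap (𝒮 0) S)).map (algebraMap (𝒮 0) S) ⊔
      Ideal.span (⋃ a ∈ {a : A | a ≠ 0}, (𝒮 a : Set S)) := by
  apply le_antisymm
  · intro s hs
    have h0 : (decompose 𝒮 s 0 : S) ∈ (𝔔.comap (algebraMap (𝒮 0) S)).map (algebraMap (𝒮 0) S) := by
      refine Ideal.mem_map_of_mem _ ?_
      rw [Ideal.mem_comap]
      exact (mem_iff_decompose_zero_mem 𝒮 𝔔 hfix s).mp hs
    have : s = (decompose 𝒮 s 0 : S) + (s - (decompose 𝒮 s 0 : S)) := by ring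
    rw [this]
    exact Submodule.add_mem_sup h0 (sub_decompose_zero_mem_span 𝒮 s)
  · refine sup_le ?_ ?_
    · rw [Ideal.map_le_iff_le_comap]
    · refine Ideal.span_le.mpr ?_
      intro t ht
      simp only [Set.mem_iUnion, Set.mem_setOf_eq, exists_prop] at ht
      obtain ⟨a, ha, hta⟩ := ht
      exact hfix a ha t hta

end Summit.ResolutionOfSingularities.ResolutionOfSingularities.Theorems.FRationalResolution.FixedPointFibre

end
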